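import Summits.CriticalPhenomena.SAWScalingLimit.Theorems.SAWLoopFugacityFlowAvoidanceLimitAnchorDefs
import Summits.CriticalPhenomena.SAWScalingLimit.Theorems.SAWLoopFugacityFlowAvoidanceLimitSawEndpoint
import Literature.Probability.LatticeModels.DiluteLoopModelAnalyticity

/-!
# Linear response ALONG A FUGACITY CURVE at `n = 0`: the compensated contact functional of the lever —
helper of `stub_cornerLipschitz`, line `saw-corner-germ` (crux `SAWLoopFugacityFlow.AvoidanceLimit`, stmt-CriticalPhenomena-10649)

The lever differentiates the route ratio `R_δ(n) = Rδ n 0 (x(n))` along the critical curve `x(n) = critLine n`.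
Whatever that curve is, IF it has a one-sided derivative `x'(0) = ℓ` at `n = 0`, the finite-volume response splits
into the loop part and the length part (the lead's assessment §1, card G1: `K = M_hit − (ℓ/x_c)|γ|`):

* `hasDerivAt_partitionFunction_along`: for ANY differentiable parameter curve `xc` with `xc 0 = x`,
  `d/dn Z_{n,0,xc n}(G, Λ; A)|₀ = ℓ · Σ_{F : no loop, no collision} |F| x^{|F|-1} + Σ_{F : one loop, no collision} x^{|F|}`
  (termwise `d/dn (xc n)^{|F|} 0^{N(F)} n^{loops}`; chain and product rules);
* `sum_loopFree_card_mul_pow_sources` / `…_empty`: on subgraphs of `ℤ²` the loop-free sums are the `x`-derivatives of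
  `Σ_γ x^{|γ|}` resp. of `1` (from the tree's `n = 0` identities, by uniqueness of derivatives);
* `hasDerivAt_log_twoLegDim_along`: hence `d/dn log twoLeg(n, xc n)|₀ = ℓ · E^γ[|γ|]/x + (L_{ab} − P·L_∅)/P`
  (`P = Σ_γ x^{|γ|}`, `L_A` the one-loop generating functions) — length response plus loop response;
* `hasDerivAt_log_ratio_along`: and for the route ratio (confined over unconfined) the DIFFERENCE of the two —
  exactly `−(E'[K'] − E[K])` of the card once `L_{ab}` is factorised over the strand (`…LogResponse.lean`).

Sources: N. Madras, G. Slade, *The Self-Avoiding Walk* (1993), §1.2–§1.3 [MadrasSlade1993]; J. L. Jacobsen, LNP 775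
(2009), ch. 14, §14.3.1 [Jacobsen2009]. No new definitions; nothing about the scaling limit or about `critLine` is
asserted here (its differentiability at `0⁺` is OPEN; this file only says what follows if a curve is differentiable).
-/

noncomputable section

open Finset
open scoped symmDiff
open Literature.Probability.RandomPlanarGeometry Literature.Probability.LatticeModels
open Summit.CriticalPhenomena.SAWScalingLimit.Theorems.AvoidanceLimit.Anchor

namespace Summit.CriticalPhenomena.SAWScalingLimit.Theorems.AvoidanceLimit.Corner

/-! ## One monomial along a curve -/

/-- `d/dn [(xc n)^k · c · n^j]|₀ = k (xc 0)^{k-1} ℓ · c · [j = 0] + (xc 0)^k · c · [j = 1]`. [folklore] -/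
theorem hasDerivAt_pow_comp_mul_pow_zero {xc : ℝ → ℝ} {ℓ : ℝ} (hxc : HasDerivAt xc ℓ 0) (c : ℝ) (k j : ℕ) :
    HasDerivAt (fun n : ℝ => xc n ^ k * c * n ^ j)
      ((if j = 0 then (k : ℝ) * xc 0 ^ (k - 1) * ℓ * c else 0) +
        (if j = 1 then xc 0 ^ k * c else 0)) 0 := by
  have h1 : HasDerivAt (fun n : ℝ => xc n ^ k * c) ((k : ℝ) * xc 0 ^ (k - 1) * ℓ * c) 0 :=
    (hxc.pow k).mul_const c
  have h2 := h1.mul (hasDerivAt_pow j (0 : ℝ))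
  refine h2.congr_deriv ?_
  rcases Nat.lt_trichotomy j 1 with hj | rfl | hj
  · have hj0 : j = 0 := by omega
    subst hj0
    simp
  · simp
  · have hne1 : j ≠ 1 := by omega
    have hne0 : j ≠ 0 := by omega
    have hj1 : j - 1 ≠ 0 := by omega
    rw [if_neg hne0, if_neg hne1, zero_pow hne0, zero_pow hj1]
    ring

/-! ## The partition function along a curve -/

/-- **`d/dn Z_{n,0,xc n}(G, Λ; A)|₀` along a differentiable fugacity curve**: `ℓ` times the loop-free length
response plus the one-loop generating function, both at `x = xc 0` and over collision-free configurations.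
[cite: MadrasSlade1993, §1.3 (length as a logarithmic derivative)] -/
theorem hasDerivAt_partitionFunction_along :
    ∀ (H : SimpleGraph (Site 2)) [H.LocallyFinite] (Λ A : Finset (Site 2)) (xc : ℝ → ℝ) (ℓ : ℝ),
      HasDerivAt xc ℓ 0 →
      HasDerivAt (fun n : ℝ => (⟨n, 0, xc n⟩ : DiluteLoopModel ℝ).partitionFunction H Λ A)
        (ℓ * (∑ F ∈ (DiluteLoopModel.configs H Λ A).filter
            (fun F => DiluteLoopModel.oscVerts Λ F = ∅ ∧ DiluteLoopModel.loops Λ F ∅ = 0),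
              (#F : ℝ) * xc 0 ^ (#F - 1)) +
          ∑ F ∈ (DiluteLoopModel.configs H Λ A).filter
            (fun F => DiluteLoopModel.oscVerts Λ F = ∅ ∧ DiluteLoopModel.loops Λ F ∅ = 1), xc 0 ^ #F) 0 := by
  intro H _ Λ A xc ℓ hxc
  classical
  -- termwise
  have hterm : ∀ F ∈ DiluteLoopModel.configs H Λ A, ∀ S ∈ (DiluteLoopModel.oscVerts Λ F).powerset,
      HasDerivAt (fun n : ℝ => (⟨n, 0, xc n⟩ : DiluteLoopModel ℝ).weight Λ F S)
        ((if DiluteLoopModel.loops Λ F S = 0 then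
            (#F : ℝ) * xc 0 ^ (#F - 1) * ℓ * (0 : ℝ) ^ #(DiluteLoopModel.oscVerts Λ F) else 0) +
          (if DiluteLoopModel.loops Λ F S = 1 then
            xc 0 ^ #F * (0 : ℝ) ^ #(DiluteLoopModel.oscVerts Λ F) else 0)) 0 := by
    intro F _ S _
    exact hasDerivAt_pow_comp_mul_pow_zero hxc ((0 : ℝ) ^ #(DiluteLoopModel.oscVerts Λ F)) (#F)
      (DiluteLoopModel.loops Λ F S)
  have hsum := HasDerivAt.fun_sum (u := DiluteLoopModel.configs H Λ A) (x := (0 : ℝ))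
    (fun F hF => HasDerivAt.fun_sum (hterm F hF))
  have hfun : (fun n : ℝ => (⟨n, 0, xc n⟩ : DiluteLoopModel ℝ).partitionFunction H Λ A) =
      fun n => ∑ F ∈ DiluteLoopModel.configs H Λ A, ∑ S ∈ (DiluteLoopModel.oscVerts Λ F).powerset,
        (⟨n, 0, xc n⟩ : DiluteLoopModel ℝ).weight Λ F S := by
    funext n
    rfl
  rw [hfun]
  refine hsum.congr_deriv ?_
  -- evaluate: collisions are killed by `0^{N(F)}`, then `S` ranges over `{∅}`
  rw [mul_sum, sum_filter, sum_filter, ← sum_add_distrib]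
  refine sum_congr rfl fun F _ => ?_
  by_cases hosc : DiluteLoopModel.oscVerts Λ F = ∅
  · rw [hosc, powerset_empty, sum_singleton]
    simp only [card_empty, pow_zero, mul_one, true_and]
    split_ifs <;> ring
  · have hpos : #(DiluteLoopModel.oscVerts Λ F) ≠ 0 := card_ne_zero.2 (nonempty_iff_ne_empty.2 hosc)
    have hL : ∑ S ∈ (DiluteLoopModel.oscVerts Λ F).powerset,
        ((if DiluteLoopModel.loops Λ F S = 0 then
            (#F : ℝ) * xc 0 ^ (#F - 1) * ℓ * (0 : ℝ) ^ #(DiluteLoopModel.oscVerts Λ F) else 0) +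
          (if DiluteLoopModel.loops Λ F S = 1 then
            xc 0 ^ #F * (0 : ℝ) ^ #(DiluteLoopModel.oscVerts Λ F) else 0)) = 0 :=
      sum_eq_zero fun S _ => by simp [zero_pow hpos]
    have hR1 : (if DiluteLoopModel.oscVerts Λ F = ∅ ∧ DiluteLoopModel.loops Λ F ∅ = 0 then
        ℓ * ((#F : ℝ) * xc 0 ^ (#F - 1)) else 0) = 0 := if_neg (fun h => hosc h.1)
    have hR2 : (if DiluteLoopModel.oscVerts Λ F = ∅ ∧ DiluteLoopModel.loops Λ F ∅ = 1 then
        xc 0 ^ #F else 0) = 0 := if_neg (fun h => hosc h.1)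
    rw [hL, hR1, hR2]
    ring

/-! ## The loop-free sums on subgraphs of `ℤ²` are `x`-derivatives of the `n = 0` identities -/

/-- On a subgraph of `ℤ²`, `a ≠ b`: `Σ_{F : sources {a,b}, no loop, no collision} |F| x^{|F|-1} = Σ_γ |γ| x^{|γ|-1}`
(differentiate the tree's `Z_{0,0,x}({a}∆{b}) = Σ_γ x^{|γ|}` in `x`). [cite: MadrasSlade1993, §1.3] -/
theorem sum_loopFree_card_mul_pow_sources {H : SimpleGraph (Site 2)} [H.LocallyFinite] (hH : H ≤ zdGraph 2)
    (x : ℝ) (Λ : Finset (Site 2)) {a b : Site 2} (hab : a ≠ b) :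
    ∑ F ∈ (DiluteLoopModel.configs H Λ ({a} ∆ {b})).filter
        (fun F => DiluteLoopModel.oscVerts Λ F = ∅ ∧ DiluteLoopModel.loops Λ F ∅ = 0),
          (#F : ℝ) * x ^ (#F - 1) =
      ∑ p ∈ DiluteLoopModel.pathsIn H Λ a b, (p.length : ℝ) * x ^ (p.length - 1) := by
  have hid : ∀ y : ℝ, ∑ F ∈ (DiluteLoopModel.configs H Λ ({a} ∆ {b})).filter
      (fun F => DiluteLoopModel.oscVerts Λ F = ∅ ∧ DiluteLoopModel.loops Λ F ∅ = 0), y ^ #F =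
        ∑ p ∈ DiluteLoopModel.pathsIn H Λ a b, y ^ p.length := fun y => by
    rw [← DiluteLoopModel.partitionFunction_zero_zero (G := H) y Λ ({a} ∆ {b}),
      DiluteLoopModel.partitionFunction_zero_zero_eq_sum_paths hH y Λ hab]
  have h1 : HasDerivAt (fun y : ℝ => ∑ F ∈ (DiluteLoopModel.configs H Λ ({a} ∆ {b})).filter
      (fun F => DiluteLoopModel.oscVerts Λ F = ∅ ∧ DiluteLoopModel.loops Λ F ∅ = 0), y ^ #F)
      (∑ F ∈ (DiluteLoopModel.configs H Λ ({a} ∆ {b})).filter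
        (fun F => DiluteLoopModel.oscVerts Λ F = ∅ ∧ DiluteLoopModel.loops Λ F ∅ = 0),
          (#F : ℝ) * x ^ (#F - 1)) x :=
    HasDerivAt.fun_sum fun F _ => hasDerivAt_pow (#F) x
  have h2 : HasDerivAt (fun y : ℝ => ∑ p ∈ DiluteLoopModel.pathsIn H Λ a b, y ^ p.length)
      (∑ p ∈ DiluteLoopModel.pathsIn H Λ a b, (p.length : ℝ) * x ^ (p.length - 1)) x :=
    HasDerivAt.fun_sum fun p _ => hasDerivAt_pow p.length x
  rw [funext hid] at h1
  exact h1.unique h2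

/-- On a subgraph of `ℤ²`: `Σ_{F : no source, no loop, no collision} |F| x^{|F|-1} = 0` (differentiate the tree's
`Z_{0,0,x}(∅) = 1` in `x`: only the empty configuration is loop-free). [cite: MadrasSlade1993, §1.2] -/
theorem sum_loopFree_card_mul_pow_empty {H : SimpleGraph (Site 2)} [H.LocallyFinite] (hH : H ≤ zdGraph 2)
    (x : ℝ) (Λ : Finset (Site 2)) :
    ∑ F ∈ (DiluteLoopModel.configs H Λ ∅).filter
        (fun F => DiluteLoopModel.oscVerts Λ F = ∅ ∧ DiluteLoopModel.loops Λ F ∅ = 0),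
          (#F : ℝ) * x ^ (#F - 1) = 0 := by
  have hid : ∀ y : ℝ, ∑ F ∈ (DiluteLoopModel.configs H Λ ∅).filter
      (fun F => DiluteLoopModel.oscVerts Λ F = ∅ ∧ DiluteLoopModel.loops Λ F ∅ = 0), y ^ #F = 1 := fun y => by
    rw [← DiluteLoopModel.partitionFunction_zero_zero (G := H) y Λ ∅,
      DiluteLoopModel.partitionFunction_zero_zero_empty hH y Λ]
  have h1 : HasDerivAt (fun y : ℝ => ∑ F ∈ (DiluteLoopModel.configs H Λ ∅).filter
      (fun F => DiluteLoopModel.oscVerts Λ F = ∅ ∧ DiluteLoopModel.loops Λ F ∅ = 0), y ^ #F)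
      (∑ F ∈ (DiluteLoopModel.configs H Λ ∅).filter
        (fun F => DiluteLoopModel.oscVerts Λ F = ∅ ∧ DiluteLoopModel.loops Λ F ∅ = 0),
          (#F : ℝ) * x ^ (#F - 1)) x :=
    HasDerivAt.fun_sum fun F _ => hasDerivAt_pow (#F) x
  have h2 : HasDerivAt (fun _ : ℝ => (1 : ℝ)) 0 x := hasDerivAt_const x 1
  rw [funext hid] at h1
  exact h1.unique h2

/-! ## The two-leg function and the route ratio along a curve -/

/-- **`d/dn log twoLeg(n, 0, xc n)|₀ = ℓ · (Σ_γ |γ| x^{|γ|-1})/P + (L_{ab} − P · L_∅)/P`** on a subgraph of `ℤ²`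
(`a ≠ b`, `x = xc 0`, `P = Σ_γ x^{|γ|} > 0`, `L_A` the one-loop generating functions): the LENGTH response driven by
the motion of the fugacity plus the LOOP response. [cite: Jacobsen2009, §14.3.1 (n → 0)] -/
theorem hasDerivAt_log_twoLegDim_along :
    ∀ (H : SimpleGraph (Site 2)) [H.LocallyFinite], H ≤ zdGraph 2 →
      ∀ (Λ : Finset (Site 2)) (a b : Site 2), a ≠ b → ∀ (xc : ℝ → ℝ) (ℓ : ℝ), HasDerivAt xc ℓ 0 →
        0 < ∑ p ∈ DiluteLoopModel.pathsIn H Λ a b, xc 0 ^ p.length →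
        HasDerivAt (fun n : ℝ => Real.log (twoLegDim n 0 (xc n) H Λ a b))
          (ℓ * (∑ p ∈ DiluteLoopModel.pathsIn H Λ a b, (p.length : ℝ) * xc 0 ^ (p.length - 1)) /
              (∑ p ∈ DiluteLoopModel.pathsIn H Λ a b, xc 0 ^ p.length) +
            ((∑ F ∈ (DiluteLoopModel.configs H Λ ({a} ∆ {b})).filter
                (fun F => DiluteLoopModel.oscVerts Λ F = ∅ ∧ DiluteLoopModel.loops Λ F ∅ = 1), xc 0 ^ #F) -
              (∑ p ∈ DiluteLoopModel.pathsIn H Λ a b, xc 0 ^ p.length) *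
                (∑ F ∈ (DiluteLoopModel.configs H Λ ∅).filter
                  (fun F => DiluteLoopModel.oscVerts Λ F = ∅ ∧ DiluteLoopModel.loops Λ F ∅ = 1), xc 0 ^ #F)) /
              (∑ p ∈ DiluteLoopModel.pathsIn H Λ a b, xc 0 ^ p.length)) 0 := by
  intro H _ hH Λ a b hab xc ℓ hxc hpos
  set Zab : ℝ → ℝ := fun n => (⟨n, 0, xc n⟩ : DiluteLoopModel ℝ).partitionFunction H Λ ({a} ∆ {b}) with hZab
  set Z0 : ℝ → ℝ := fun n => (⟨n, 0, xc n⟩ : DiluteLoopModel ℝ).partitionFunction H Λ ∅ with hZ0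
  set P : ℝ := ∑ p ∈ DiluteLoopModel.pathsIn H Λ a b, xc 0 ^ p.length with hP
  set T : ℝ := ∑ p ∈ DiluteLoopModel.pathsIn H Λ a b, (p.length : ℝ) * xc 0 ^ (p.length - 1) with hT
  set Lab : ℝ := ∑ F ∈ (DiluteLoopModel.configs H Λ ({a} ∆ {b})).filter
    (fun F => DiluteLoopModel.oscVerts Λ F = ∅ ∧ DiluteLoopModel.loops Λ F ∅ = 1), xc 0 ^ #F with hLab
  set L0 : ℝ := ∑ F ∈ (DiluteLoopModel.configs H Λ ∅).filter
    (fun F => DiluteLoopModel.oscVerts Λ F = ∅ ∧ DiluteLoopModel.loops Λ F ∅ = 1), xc 0 ^ #F with hL0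
  have hZab0 : Zab 0 = P := by
    simp only [hZab, hP]
    exact DiluteLoopModel.partitionFunction_zero_zero_eq_sum_paths hH (xc 0) Λ hab
  have hZ00 : Z0 0 = 1 := by
    simp only [hZ0]
    exact DiluteLoopModel.partitionFunction_zero_zero_empty hH (xc 0) Λ
  have hdab : HasDerivAt Zab (ℓ * T + Lab) 0 := by
    have h := hasDerivAt_partitionFunction_along H Λ ({a} ∆ {b}) xc ℓ hxc
    rw [sum_loopFree_card_mul_pow_sources hH (xc 0) Λ hab] at h
    exact h
  have hd0 : HasDerivAt Z0 L0 0 := by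
    have h := hasDerivAt_partitionFunction_along H Λ ∅ xc ℓ hxc
    rw [sum_loopFree_card_mul_pow_empty hH (xc 0) Λ, mul_zero, zero_add] at h
    exact h
  have hfun : (fun n : ℝ => Real.log (twoLegDim n 0 (xc n) H Λ a b)) = fun n => Real.log (Zab n / Z0 n) := by
    funext n
    simp only [twoLegDim, hZab, hZ0, dimerPF_dimerFugacity_zero]
  rw [hfun]
  have hne : Zab 0 / Z0 0 ≠ 0 := by
    rw [hZab0, hZ00, div_one]
    exact hpos.ne'
  have hlog := (hdab.fun_div hd0 (by rw [hZ00]; exact one_ne_zero)).log hne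
  refine hlog.congr_deriv ?_
  rw [hZab0, hZ00]
  have hP0 : P ≠ 0 := hpos.ne'
  field_simp
  ring

/-- **Response of the route ratio along a curve** (`t = 0`; confined graph over `Ω_δ`, common volume; both path
generating functions positive at `x = xc 0`): `d/dn log R_δ(n, 0, xc n)|₀` is the difference of the two-leg responses
`hasDerivAt_log_twoLegDim_along` of the confined graph and of `Ω_δ` — the DIFFERENCED, length-compensated functional
of the lever once `ℓ = critLine'(0)` (if that derivative exists). [cite: MadrasSlade1993, §1.3] -/
theorem hasDerivAt_log_ratio_along :
    ∀ (Ω S : Set ℂ) (δ : ℝ) (a b : Site 2), a ≠ b → ∀ (xc : ℝ → ℝ) (ℓ : ℝ), HasDerivAt xc ℓ 0 →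
    0 < ∑ p ∈ DiluteLoopModel.pathsIn (confinedGraph Ω S δ) (meshDomainFinset Ω δ) a b, xc 0 ^ p.length →
    0 < ∑ p ∈ DiluteLoopModel.pathsIn (discreteDomainGraph Ω δ) (meshDomainFinset Ω δ) a b, xc 0 ^ p.length →
    HasDerivAt (fun n : ℝ => Real.log (Rδ n 0 (xc n) Ω S δ a b))
      ((ℓ * (∑ p ∈ DiluteLoopModel.pathsIn (confinedGraph Ω S δ) (meshDomainFinset Ω δ) a b,
              (p.length : ℝ) * xc 0 ^ (p.length - 1)) /
            (∑ p ∈ DiluteLoopModel.pathsIn (confinedGraph Ω S δ) (meshDomainFinset Ω δ) a b, xc 0 ^ p.length) +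
          ((∑ F ∈ (DiluteLoopModel.configs (confinedGraph Ω S δ) (meshDomainFinset Ω δ) ({a} ∆ {b})).filter
              (fun F => DiluteLoopModel.oscVerts (meshDomainFinset Ω δ) F = ∅ ∧
                DiluteLoopModel.loops (meshDomainFinset Ω δ) F ∅ = 1), xc 0 ^ #F) -
            (∑ p ∈ DiluteLoopModel.pathsIn (confinedGraph Ω S δ) (meshDomainFinset Ω δ) a b, xc 0 ^ p.length) *
              (∑ F ∈ (DiluteLoopModel.configs (confinedGraph Ω S δ) (meshDomainFinset Ω δ) ∅).filter
                (fun F => DiluteLoopModel.oscVerts (meshDomainFinset Ω δ) F = ∅ ∧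
                  DiluteLoopModel.loops (meshDomainFinset Ω δ) F ∅ = 1), xc 0 ^ #F)) /
            (∑ p ∈ DiluteLoopModel.pathsIn (confinedGraph Ω S δ) (meshDomainFinset Ω δ) a b, xc 0 ^ p.length)) -
        (ℓ * (∑ p ∈ DiluteLoopModel.pathsIn (discreteDomainGraph Ω δ) (meshDomainFinset Ω δ) a b,
              (p.length : ℝ) * xc 0 ^ (p.length - 1)) /
            (∑ p ∈ DiluteLoopModel.pathsIn (discreteDomainGraph Ω δ) (meshDomainFinset Ω δ) a b, xc 0 ^ p.length) +
          ((∑ F ∈ (DiluteLoopModel.configs (discreteDomainGraph Ω δ) (meshDomainFinset Ω δ) ({a} ∆ {b})).filter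
              (fun F => DiluteLoopModel.oscVerts (meshDomainFinset Ω δ) F = ∅ ∧
                DiluteLoopModel.loops (meshDomainFinset Ω δ) F ∅ = 1), xc 0 ^ #F) -
            (∑ p ∈ DiluteLoopModel.pathsIn (discreteDomainGraph Ω δ) (meshDomainFinset Ω δ) a b, xc 0 ^ p.length) *
              (∑ F ∈ (DiluteLoopModel.configs (discreteDomainGraph Ω δ) (meshDomainFinset Ω δ) ∅).filter
                (fun F => DiluteLoopModel.oscVerts (meshDomainFinset Ω δ) F = ∅ ∧
                  DiluteLoopModel.loops (meshDomainFinset Ω δ) F ∅ = 1), xc 0 ^ #F)) /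
            (∑ p ∈ DiluteLoopModel.pathsIn (discreteDomainGraph Ω δ) (meshDomainFinset Ω δ) a b,
              xc 0 ^ p.length))) 0 := by
  intro Ω S δ a b hab xc ℓ hxc hpos' hpos
  have hG' : confinedGraph Ω S δ ≤ zdGraph 2 := confinedGraph_le_zdGraph Ω S δ
  have hG : discreteDomainGraph Ω δ ≤ zdGraph 2 :=
    (discreteDomainGraph_le_meshGraph Ω δ).trans (meshGraph_le_zdGraph Ω δ)
  have h1 := hasDerivAt_log_twoLegDim_along _ hG' (meshDomainFinset Ω δ) a b hab xc ℓ hxc hpos'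
  have h2 := hasDerivAt_log_twoLegDim_along _ hG (meshDomainFinset Ω δ) a b hab xc ℓ hxc hpos
  have hv1 : twoLegDim (0 : ℝ) 0 (xc 0) (confinedGraph Ω S δ) (meshDomainFinset Ω δ) a b =
      ∑ p ∈ DiluteLoopModel.pathsIn (confinedGraph Ω S δ) (meshDomainFinset Ω δ) a b, xc 0 ^ p.length :=
    twoLegDim_zero_zero_eq_sum_paths hG' (xc 0) _ hab
  have hv2 : twoLegDim (0 : ℝ) 0 (xc 0) (discreteDomainGraph Ω δ) (meshDomainFinset Ω δ) a b =
      ∑ p ∈ DiluteLoopModel.pathsIn (discreteDomainGraph Ω δ) (meshDomainFinset Ω δ) a b, xc 0 ^ p.length :=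
    twoLegDim_zero_zero_eq_sum_paths hG (xc 0) _ hab
  have hpos1 : ∀ᶠ n in nhds (0 : ℝ), 0 < twoLegDim n 0 (xc n) (confinedGraph Ω S δ) (meshDomainFinset Ω δ) a b := by
    have hc : ContinuousAt (fun n : ℝ => twoLegDim n 0 (xc n) (confinedGraph Ω S δ) (meshDomainFinset Ω δ) a b) 0 := by
      have h := (hasDerivAt_partitionFunction_along (confinedGraph Ω S δ) (meshDomainFinset Ω δ) ({a} ∆ {b})
        xc ℓ hxc).continuousAt.div (hasDerivAt_partitionFunction_along (confinedGraph Ω S δ)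
        (meshDomainFinset Ω δ) ∅ xc ℓ hxc).continuousAt (by
          rw [DiluteLoopModel.partitionFunction_zero_zero_empty hG' (xc 0)]; exact one_ne_zero)
      simp only [twoLegDim, dimerPF_dimerFugacity_zero]
      exact h
    have h0 : 0 < twoLegDim (0 : ℝ) 0 (xc 0) (confinedGraph Ω S δ) (meshDomainFinset Ω δ) a b := by
      rw [hv1]; exact hpos'
    exact hc.eventually (Ioi_mem_nhds h0)
  have hpos2 : ∀ᶠ n in nhds (0 : ℝ), 0 < twoLegDim n 0 (xc n) (discreteDomainGraph Ω δ) (meshDomainFinset Ω δ) a b := by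
    have hc : ContinuousAt (fun n : ℝ => twoLegDim n 0 (xc n) (discreteDomainGraph Ω δ) (meshDomainFinset Ω δ) a b) 0 := by
      have h := (hasDerivAt_partitionFunction_along (discreteDomainGraph Ω δ) (meshDomainFinset Ω δ) ({a} ∆ {b})
        xc ℓ hxc).continuousAt.div (hasDerivAt_partitionFunction_along (discreteDomainGraph Ω δ)
        (meshDomainFinset Ω δ) ∅ xc ℓ hxc).continuousAt (by
          rw [DiluteLoopModel.partitionFunction_zero_zero_empty hG (xc 0)]; exact one_ne_zero)
      simp only [twoLegDim, dimerPF_dimerFugacity_zero]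
      exact h
    have h0 : 0 < twoLegDim (0 : ℝ) 0 (xc 0) (discreteDomainGraph Ω δ) (meshDomainFinset Ω δ) a b := by
      rw [hv2]; exact hpos
    exact hc.eventually (Ioi_mem_nhds h0)
  -- `log R = log twoLeg' − log twoLeg` near `0`
  have heq : (fun n : ℝ => Real.log (Rδ n 0 (xc n) Ω S δ a b)) =ᶠ[nhds 0] fun n =>
      Real.log (twoLegDim n 0 (xc n) (confinedGraph Ω S δ) (meshDomainFinset Ω δ) a b) -
        Real.log (twoLegDim n 0 (xc n) (discreteDomainGraph Ω δ) (meshDomainFinset Ω δ) a b) := by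
    filter_upwards [hpos1, hpos2] with n hn1 hn2
    show Real.log (twoLegDim n 0 (xc n) (confinedGraph Ω S δ) (meshDomainFinset Ω δ) a b /
      twoLegDim n 0 (xc n) (discreteDomainGraph Ω δ) (meshDomainFinset Ω δ) a b) = _
    rw [Real.log_div hn1.ne' hn2.ne']
  exact (h1.sub h2).congr_of_eventuallyEq heq

end Summit.CriticalPhenomena.SAWScalingLimit.Theorems.AvoidanceLimit.Corner

end
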